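import Literature.AlgebraicGeometry.Motives.LinesGenerateChowOneRational
import HarnessLib

/-!
# `CH₁(X)/⟨lines⟩` is torsion when `X` is chain connected by lines — and for cubics and pairs of quadrics (Tian–Zong's product trick for chains)

Companion to `Motives/LinesGenerateChowOneRational` (chains of two lines, existing by a dimension
count when `Σ (2 dᵢ - 1) ≤ N`). Tian–Zong, *One-cycles on rationally connected varieties*
(Compositio Math. 150 (2014)), proof of Thm. 6.1, first step: "By the assumption, `X` is
rationally chain connected by chains of lines (Lemma 4.8.1, Chap. V of [Kollár]). … `CH₀(F(X)) ⊗ ℚ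
→ CH₁(X) ⊗ ℚ` is surjective", by the product trick of Prop. 7.1 ("after a base change `S → C`
there is a rational curve in `X ×_C K(S)` connecting `Γ ×_C K(S)` and `C' ×_C K(S)`. Thus there is
a ruled surface with two sections … The result follows from pushing forward everything to `X` and
the fact that the push-forward of `C'` is `0`"). This file proves that step for chains of LINES of
arbitrary length with the chain connectedness as an explicit hypothesis, and discharges the
hypothesis elementarily — by chains of THREE lines — for cubic hypersurfaces (`N ≥ 4`, so cubic
threefolds are included) and intersections of two quadrics (`N ≥ 5`):

* `ProjFamily.exists_pos_smul_primeCycle_ratEquiv_lines_of_chain`,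
  `exists_pos_smul_mem_closure_lineClasses_of_chain`, `isTorsion_chowGroupOne_quot_lineClasses_of_chain`
  — for `X ⊆ ℙᴺ_k` (`k` algebraically closed) closed with underlying set `V₊(F₁, …, F_c)`,
  `deg F_a = d_a ≥ 1`: if over every algebraically closed `L ⊇ k` any two non-zero zeros of the
  `F_a` are joined by a chain `v₀ = p, …, v_{r+1} = q` of non-zero vectors with the `F_a` vanishing
  on the span of each consecutive pair, then every class of `CH₁(X)` has a positive multiple in the
  subgroup generated by the line classes. Proof: for an integral curve `C` with function field `K`
  the chain from its generic point to a closed point over the algebraic closure of `K` descends to a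
  finite extension `E/K` (`ProjFamily.exists_finite_extension_chain`); over the normalisation `Z`
  of `C` in `E` (`Motives/HirschowitzIyerParameterCurve`, `K(Z) ≅ E`) each link sweeps a ruled
  surface in `X ×ₖ Z` whose two sections are rationally equivalent modulo vertical lines
  (`ProjFamily.exists_relation_of_line`); the relations telescope, and pushing forward to `X` the
  first section gives `e [C]`, `e ≠ 0` (`ProjFamily.mapCoeff_ne_zero_of_height_eq`), the last is
  contracted.
* `ProjFamily.exists_line_between_lines_of_cubic`, `…_of_two_quadrics` — **any two lines of a cubic
  hypersurface (of an intersection of two quadrics) are joined by a line of it**, over an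
  algebraically closed field: with `m₁ = c₀ w₀ + c₁ w₁` on the first line, the conditions for the
  line `m₁ m₂` to lie on `V(F)` are the `s`-levels of `F(s₀ w₀ + s₁ w₁ + m₂)`
  (`ProjFamily.framePoly`, `levelSum`, bihomogeneity from `Literature.RingTheory.MvPolynomial`);
  the level linear in `m₂` is solved on the second line by `m₂(c) = E(c, z₁) z₀ - E(c, z₀) z₁`, and
  the remaining level becomes a binary form in `c` (of degree `5`, resp. `2`), which has a zero.
* `ProjFamily.exists_chain_of_cubic`, `ProjFamily.exists_chain_of_two_quadrics` — hence any two
  points are joined by a chain of three lines (a line through each point by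
  `exists_finCons_forall_eval_eq_zero`: `3 + 1 < N + 1`, resp. `2 + 2 + 1 < N + 1`), and
  `exists_pos_smul_mem_closure_lineClasses_of_cubic` / `…_of_two_quadrics`,
  `isTorsion_chowGroupOne_quot_lineClasses_of_cubic` / `…_of_two_quadrics`:
  **`CH₁(X) ⊗ ℚ` is spanned by lines for every cubic hypersurface of dimension `≥ 3` and every
  intersection of two quadrics of dimension `≥ 3`** — the cases `d = (3)`, `(2, 2)` of the range
  `Σ d_a ≤ N - 1` of the named fact `TianZong2014_chowOne_generatedByLines` (rational coefficients
  only; the integral statement needs Tian–Zong's Prop. 3.1 and Thms. 1.3, 6.2, not in the tree).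

For longer chains (the full range `Σ d_a ≤ N - 1`, Kollár V.4.8.1) the existence of the middle
links is a multiprojective Bézout statement not available in the tree. Everything here is proved;
the definitions are the bookkeeping `levelSum`, `levelPoly`, `framePoly`, `frameVec`.

## References

* [TianZong2014] Z. Tian, H. R. Zong, *One-cycles on rationally connected varieties*, Compositio
  Math. 150 (2014), Prop. 7.1 and its proof, proof of Thm. 6.1, Thm. 1.7.
* [Fulton1998] W. Fulton, *Intersection Theory*, Thm. 1.4.
* [Liu2002] Q. Liu, *Algebraic Geometry and Arithmetic Curves*, Def. 4.1.24 (normalisation in a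
  finite extension).
-/

noncomputable section

open CategoryTheory CategoryTheory.Limits AlgebraicGeometry MonoidalCategory MvPolynomial
  TopologicalSpace Order

universe u

namespace Literature.AlgebraicGeometry.Motives

attribute [local instance] MvPolynomial.gradedAlgebra MvPolynomial.algebraMvPolynomial
  Literature.AlgebraicGeometry.Motives.ProjBaseChange.algebraBase
  UniversalHyperplaneSection.sectionsAlgebra ProjFamily.functionFieldAlgebra

namespace ProjFamily

open ProjBaseChangeRing ProjectiveSpaceCells ProjectiveSpace Literature.RingTheory.MvPolynomial
  Literature.FieldTheory.QuasiAlgClosed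

variable {k : Type u} [Field k]

/-! ### Chains of lines over a finite extension: descent -/

section ChainDescent

variable {K : Type u} [Field K] {N : ℕ}

omit [Field k] in
/-- **Descent of a chain of lines to a finite extension.** A chain `v₀ = p, v₁, …, v_{r+1} = q` of
non-zero vectors over the algebraic closure `Ω` of `K`, with the forms `F_a` (coefficients in `K`)
vanishing on the span of each consecutive pair, is defined over the finite extension `E ⊆ Ω` of
`K` generated by its coordinates. [folklore] -/
theorem exists_finite_extension_chain {c : ℕ} {F : Fin c → MvPolynomial (Fin (N + 1)) K}
    {p q : Fin (N + 1) → K} {r : ℕ} {v : ℕ → Fin (N + 1) → AlgebraicClosure K}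
    (hv0 : v 0 = (algebraMap K (AlgebraicClosure K)) ∘ p)
    (hvr : v (r + 1) = (algebraMap K (AlgebraicClosure K)) ∘ q) (hvne : ∀ j ≤ r + 1, v j ≠ 0)
    (hlink : ∀ j ≤ r, ∀ a (s t : AlgebraicClosure K),
      eval (s • v j + t • v (j + 1)) (MvPolynomial.map (algebraMap K (AlgebraicClosure K)) (F a)) = 0) :
    ∃ (E : IntermediateField K (AlgebraicClosure K)), FiniteDimensional K E ∧
      ∃ w : ℕ → Fin (N + 1) → E, w 0 = (algebraMap K E) ∘ p ∧ w (r + 1) = (algebraMap K E) ∘ q ∧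
        (∀ j ≤ r + 1, w j ≠ 0) ∧
        ∀ j ≤ r, ∀ a (s t : E),
          eval (s • w j + t • w (j + 1)) (MvPolynomial.map (algebraMap K E) (F a)) = 0 := by
  classical
  let Ω := AlgebraicClosure K
  -- the finite extension generated by all coordinates of the chain
  let S : Set Ω := Set.range (fun ji : Fin (r + 2) × Fin (N + 1) => v ji.1 ji.2)
  let E : IntermediateField K Ω := IntermediateField.adjoin K S
  haveI : Finite ↥S := (Set.finite_range _).to_subtype
  have hfin : FiniteDimensional K E :=
    IntermediateField.finiteDimensional_adjoin fun x _ =>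
      (Algebra.IsAlgebraic.isAlgebraic (R := K) x).isIntegral
  have hmem : ∀ j ≤ r + 1, ∀ i, v j i ∈ E := fun j hj i =>
    IntermediateField.subset_adjoin K S ⟨(⟨j, by omega⟩, i), rfl⟩
  -- the chain with coordinates in `E`
  let w : ℕ → Fin (N + 1) → E := fun j i =>
    if h : j ≤ r + 1 then ⟨v j i, hmem j h i⟩ else 0
  have hwval : ∀ j ≤ r + 1, (algebraMap E Ω) ∘ w j = v j := fun j hj => by
    funext i
    simp only [w, Function.comp_apply, dif_pos hj]
    rfl
  have hKE : ∀ x : K, ((algebraMap K E x : E) : Ω) = algebraMap K Ω x := fun x =>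
    (IsScalarTower.algebraMap_apply K E Ω x).symm
  refine ⟨E, hfin, w, ?_, ?_, fun j hj hw0 => hvne j hj ?_, fun j hj a s t => ?_⟩
  · funext i
    apply Subtype.ext
    change ((w 0 i : E) : Ω) = ((algebraMap K E (p i) : E) : Ω)
    rw [hKE, show ((w 0 i : E) : Ω) = ((algebraMap E Ω) ∘ w 0) i from rfl,
      hwval 0 (Nat.zero_le _), hv0]
    rfl
  · funext i
    apply Subtype.ext
    change ((w (r + 1) i : E) : Ω) = ((algebraMap K E (q i) : E) : Ω)
    rw [hKE, show ((w (r + 1) i : E) : Ω) = ((algebraMap E Ω) ∘ w (r + 1)) i from rfl,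
      hwval (r + 1) le_rfl, hvr]
    rfl
  · rw [← hwval j hj, hw0]
    funext i
    exact map_zero _
  · apply (algebraMap E Ω).injective
    rw [map_zero, ← eval_comp_map, comp_smul_add_smul, hwval j (by omega), hwval (j + 1) (by omega),
      MvPolynomial.map_map, ← IsScalarTower.algebraMap_eq]
    exact hlink j hj a _ _

end ChainDescent

/-! ### The relation `e · [C] ~ Σ nᵢ [ℓᵢ]` from a chain of lines over the algebraic closure -/

section MainChain

variable [IsAlgClosed k] {N : ℕ} (X : SchemeOver k) (i : X ⟶ projectiveSpace N k)
  [IsClosedImmersion i.left]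

omit [IsAlgClosed k] [IsClosedImmersion i.left] in
/-- A `K`-point of `ℙᴺ_K` whose coordinates annihilate the equations of `X` lies in the generic
fibre `X_K`. [folklore] -/
theorem pt_pointOfVec_mem_range_iK (B : SchemeOver k) [IsIntegral B.left] {c : ℕ}
    (F : Fin c → MvPolynomial (Fin (N + 1)) k) (d : Fin c → ℕ)
    (hFhom : ∀ b, (F b).IsHomogeneous (d b)) (hd : ∀ b, 0 < d b)
    (hrange : Set.range i.left.base =
      ProjectiveSpectrum.zeroLocus (homogeneousSubmodule (Fin (N + 1)) k) (Set.range F))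
    (v : Fin (N + 1) → B.left.functionField) (hv : v ≠ 0)
    (hFv : ∀ b, eval v (MvPolynomial.map (algebraMap k B.left.functionField) (F b)) = 0) :
    (pointOfVec B.left.functionField v hv).pt ∈ Set.range (iK N B X i).base := by
  refine (Set.ext_iff.mp (range_iK N B X i) _).mpr ?_
  rw [Set.mem_preimage]
  refine (Set.ext_iff.mp (range_whiskerRight_left N B X i) _).mpr ?_
  rw [Set.mem_preimage]
  refine (Set.ext_iff.mp hrange _).mpr ?_
  have hfst : (CartesianMonoidalCategory.fst (projectiveSpace N k) B).left.base
      ((genericFibreι N B).base (pointOfVec B.left.functionField v hv).pt) =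
      (Proj.map (mapGraded k B.left.functionField (Fin (N + 1)))
        (irrelevant_le_map k B.left.functionField (Fin (N + 1)))).base
        (pointOfVec B.left.functionField v hv).pt := by
    change ((genericFibreι N B ≫
      (CartesianMonoidalCategory.fst (projectiveSpace N k) B).left).base _) = _
    rw [genericFibreι_fst]
    rfl
  rw [hfst]
  rintro _ ⟨b, rfl⟩
  change F b ∈ ProjectiveSpectrum.asHomogeneousIdeal _
  rw [ProjectiveSpectrum.mem_asHomogeneousIdeal_map_iff]
  exact mem_asHomogeneousIdeal_pt_pointOfVec hv (hd b) ((hFhom b).map _) (hFv b)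

set_option maxHeartbeats 400000 in
/-- **A positive multiple of a curve class is an integral combination of lines, given a chain of
lines over the algebraic closure of the function field** (Tian–Zong's product trick, Prop. 7.1,
"after a base change `S → C` there is a rational curve … connecting … Thus there is a ruled
surface with two sections …", for chains of LINES of any length). Let `X = V₊(F) ⊆ ℙᴺ_k` be closed
with `F` of degrees `d_a ≥ 1`, `k` algebraically closed, and assume that over every algebraically
closed field `L ⊇ k` any two zeros `p, q` of the `F_a` are joined by a chain of lines of `V(F)`:
vectors `v₀ = p, v₁, …, v_{r+1} = q`, non-zero, with the `F_a` vanishing on the span of each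
consecutive pair (`hchain`; consecutive vectors may be proportional). Then for every integral
curve `C = closure {z₀} ⊆ X` there is `e > 0` with `e [C] ∈ Σ ℤ [lines] + Rat₁(X)`: the chain
joining the generic point of `C` to a closed point over the algebraic closure of `K = k(C)` is
defined over a finite extension `E/K` (`exists_finite_extension_chain`); on the normalisation `Z`
of `C` in `E` each link gives a ruled surface in `X ×ₖ Z` whose two sections are rationally
equivalent modulo vertical lines (`exists_relation_of_line`); the relations telescope, and pushing
forward to `X` the first section gives `e [C]` with `e ≠ 0` (`mapCoeff_ne_zero_of_height_eq`) and
the last section is contracted. This is the form in which the rational chain connectedness of `X`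
by lines (Kollár, *Rational Curves on Algebraic Varieties*, V.4.8.1, for `Σ d_a ≤ N - 1`; not in
the tree) would give the torsion statement in the full range of Tian–Zong's Thm. 6.1.
[cite: TianZong2014, Prop. 7.1 and proof of Thm. 6.1] -/
theorem exists_pos_smul_primeCycle_ratEquiv_lines_of_chain (hN : 1 ≤ N)
    {c : ℕ} (F : Fin c → MvPolynomial (Fin (N + 1)) k) (d : Fin c → ℕ)
    (hFhom : ∀ b, (F b).IsHomogeneous (d b)) (hd : ∀ b, 0 < d b)
    (hrange : Set.range i.left.base =
      ProjectiveSpectrum.zeroLocus (homogeneousSubmodule (Fin (N + 1)) k) (Set.range F))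
    (hchain : ∀ (L : Type u) [Field L] [IsAlgClosed L] [Algebra k L] (p q : Fin (N + 1) → L),
      p ≠ 0 → q ≠ 0 → (∀ a, eval p (MvPolynomial.map (algebraMap k L) (F a)) = 0) →
      (∀ a, eval q (MvPolynomial.map (algebraMap k L) (F a)) = 0) →
      ∃ (r : ℕ) (v : ℕ → Fin (N + 1) → L), v 0 = p ∧ v (r + 1) = q ∧ (∀ j ≤ r + 1, v j ≠ 0) ∧
        ∀ j ≤ r, ∀ a (s t : L),
          eval (s • v j + t • v (j + 1)) (MvPolynomial.map (algebraMap k L) (F a)) = 0)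
    (z₀ : ↥X.left) (hz : height z₀ = 1) :
    ∃ e : ℕ, 0 < e ∧ ∃ (s : Finset ↥X.left) (w : ↥X.left → ℤ), (∀ y ∈ s, IsLinePoint N i y) ∧
      IsRationallyEquivalent ((e : ℤ) • primeCycle z₀) (∑ y ∈ s, w y • primeCycle y) 1 := by
  classical
  -- instances on `X`
  haveI : IsProper (projectiveSpace N k).hom := isProper_projectiveSpace N k
  haveI : IsProper X.hom := by rw [← Over.w i]; infer_instance
  -- the curve `W = closure {z₀}` over `k` and its generic point as a `K`-point of `X`
  let W : SchemeOver k := curveOf z₀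
  let aW : Spec W.left.functionField ⟶ X.left := qgen W ≫ (ClosedSubvariety.ofPoint X.left z₀).ι
  have haW : aW ≫ X.hom = qgen W ≫ W.hom := by
    simp only [aW, Category.assoc]
    rfl
  have hqgenW : (qgen W).base (IsLocalRing.closedPoint W.left.functionField) = genericPoint W.left := by
    have h : (qgen W).base (IsLocalRing.closedPoint W.left.functionField) ∈ Set.range (qgen W).base :=
      ⟨_, rfl⟩
    rwa [range_qgen, Set.mem_singleton_iff] at h
  have haWpt : aW.base (IsLocalRing.closedPoint W.left.functionField) = z₀ := by
    change (ClosedSubvariety.ofPoint X.left z₀).ι.base ((qgen W).base _) = z₀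
    rw [hqgenW]
    exact ClosedSubvariety.genericPoint_ofPoint z₀
  -- a closed point `x₀` of `X` below `z₀` and the constant `K`-point at `x₀`
  obtain ⟨x₀, hx₀lt⟩ : ∃ x₀, x₀ < z₀ := by
    have h : ¬ IsMin z₀ := fun hmin => by
      have := Order.height_eq_zero.mpr hmin
      rw [hz] at this
      exact one_ne_zero this
    simpa [not_isMin_iff] using h
  have hx₀0 : height x₀ = 0 := by
    have h := height_strictMono hx₀lt (by
      refine lt_of_le_of_lt (height_mono hx₀lt.le) ?_
      rw [hz]; exact ENat.coe_lt_top 1)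
    rw [hz] at h
    exact Order.lt_one_iff.mp h
  have hx₀ : IsClosed ({x₀} : Set ↥X.left) := isClosed_singleton_of_height_eq_zero' hx₀0
  let a₀W : Spec W.left.functionField ⟶ X.left :=
    qgen W ≫ W.hom ≫ pointOfClosedPoint X.hom x₀ hx₀
  have ha₀W : a₀W ≫ X.hom = qgen W ≫ W.hom := by
    simp only [a₀W, Category.assoc, pointOfClosedPoint_comp, Category.comp_id]
  have ha₀Wpt : a₀W.base (IsLocalRing.closedPoint W.left.functionField) = x₀ :=
    pointOfClosedPoint_apply X.hom x₀ hx₀ _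
  -- homogeneous coordinates `p, q ∈ Kᴺ⁺¹`
  obtain ⟨p, hp0, hPp⟩ := exists_eq_pointOfVec (algPt N W X i aW haW)
  obtain ⟨q, hq0, hPq⟩ := exists_eq_pointOfVec (algPt N W X i a₀W ha₀W)
  have hptp : (pointOfVec W.left.functionField p hp0).pt = uPt N W X i aW haW := by
    rw [← hPp]; rfl
  have hptq : (pointOfVec W.left.functionField q hq0).pt = uPt N W X i a₀W ha₀W := by
    rw [← hPq]; rfl
  have hFmem : ∀ (a' : Spec W.left.functionField ⟶ X.left) (ha' : a' ≫ X.hom = qgen W ≫ W.hom) b,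
      MvPolynomial.map (algebraMap k W.left.functionField) (F b) ∈
        ProjectiveSpectrum.asHomogeneousIdeal
          (𝒜 := homogeneousSubmodule (Fin (N + 1)) W.left.functionField) (uPt N W X i a' ha') := by
    intro a' ha' b
    refine map_mem_asHomogeneousIdeal_uPt N W X i a' ha' ?_
    have hmem : i.left.base (a'.base (IsLocalRing.closedPoint W.left.functionField)) ∈
        Set.range i.left.base := ⟨_, rfl⟩
    rw [hrange] at hmem
    exact hmem ⟨b, rfl⟩
  have hFp : ∀ b, eval p (MvPolynomial.map (algebraMap k W.left.functionField) (F b)) = 0 :=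
    fun b => eval_eq_zero_of_mem_asHomogeneousIdeal_pt_pointOfVec hp0 (hd b) ((hFhom b).map _)
      (hptp ▸ hFmem aW haW b)
  have hFq : ∀ b, eval q (MvPolynomial.map (algebraMap k W.left.functionField) (F b)) = 0 :=
    fun b => eval_eq_zero_of_mem_asHomogeneousIdeal_pt_pointOfVec hq0 (hd b) ((hFhom b).map _)
      (hptq ▸ hFmem a₀W ha₀W b)
  -- the images of `[p]`, `[q]` in `ℙᴺ_k` are `i z₀`, `i x₀`
  have hip : (pointOfVec k p hp0).pt = i.left.base z₀ := by
    rw [← projMap_pt_pointOfVec, hptp, ← i_apply_eq_projMap_uPt N W X i aW haW, haWpt]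
  have hiq : (pointOfVec k q hq0).pt = i.left.base x₀ := by
    rw [← projMap_pt_pointOfVec, hptq, ← i_apply_eq_projMap_uPt N W X i a₀W ha₀W, ha₀Wpt]
  -- the chain over the algebraic closure `Ω` of `K`, and its descent to a finite extension `E`
  let Ω := AlgebraicClosure W.left.functionField
  have hFΩ : ∀ b, MvPolynomial.map (algebraMap k Ω) (F b) =
      MvPolynomial.map (algebraMap W.left.functionField Ω)
        (MvPolynomial.map (algebraMap k W.left.functionField) (F b)) := fun b => by
    rw [MvPolynomial.map_map, ← IsScalarTower.algebraMap_eq]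
  have hpΩ : ∀ b, eval ((algebraMap W.left.functionField Ω) ∘ p)
      (MvPolynomial.map (algebraMap k Ω) (F b)) = 0 := fun b => by
    rw [hFΩ, eval_comp_map, hFp b, map_zero]
  have hqΩ : ∀ b, eval ((algebraMap W.left.functionField Ω) ∘ q)
      (MvPolynomial.map (algebraMap k Ω) (F b)) = 0 := fun b => by
    rw [hFΩ, eval_comp_map, hFq b, map_zero]
  have hpΩ0 : (algebraMap W.left.functionField Ω) ∘ p ≠ 0 := fun h0 => hp0 (by
    funext j
    exact (algebraMap W.left.functionField Ω).injective ((congrFun h0 j).trans (map_zero _).symm))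
  have hqΩ0 : (algebraMap W.left.functionField Ω) ∘ q ≠ 0 := fun h0 => hq0 (by
    funext j
    exact (algebraMap W.left.functionField Ω).injective ((congrFun h0 j).trans (map_zero _).symm))
  obtain ⟨r, v, hv0, hvr, hvne, hlink⟩ := hchain Ω _ _ hpΩ0 hqΩ0 hpΩ hqΩ
  obtain ⟨E, hEfin, wE, hwE0, hwEr, hwEne, hwElink⟩ := exists_finite_extension_chain
    (F := fun b => MvPolynomial.map (algebraMap k W.left.functionField) (F b)) hv0 hvr hvne
    (fun j hj b s t => by rw [← hFΩ]; exact hlink j hj b s t)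
  haveI : FiniteDimensional W.left.functionField E := hEfin
  -- the normalisation `Z` of `W` in `E`
  let Z : SchemeOver k := paramCurve z₀ (↥E)
  have hZ1 : height (genericPoint Z.left) = 1 := by
    rw [height_genericPoint_paramCurve]; exact hz
  have hpid : ∀ b : Z.left, IsClosed ({b} : Set Z.left) →
      IsPrincipalIdealRing (Z.left.presheaf.stalk b) := by
    intro b hb
    have hne : b ≠ genericPoint Z.left := fun h => by
      have h0 := height_eq_zero_of_isClosed_singleton hb
      rw [h, hZ1] at h0
      exact one_ne_zero h0
    haveI := isDiscreteValuationRing_stalk_paramCurve z₀ (↥E) hz hne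
    infer_instance
  -- `K(Z) ≅ E` and the `k`-algebra map `ψ : K → K(Z)`
  let g : specOver k (↥E) ⟶ Z := paramGen z₀ (↥E)
  have hg : g.left.base (IsLocalRing.closedPoint (↥E)) = genericPoint Z.left := by
    have h : g.left.base (IsLocalRing.closedPoint (↥E)) ∈ Set.range g.left.base := ⟨_, rfl⟩
    have hr : Set.range g.left.base = {genericPoint Z.left} := range_paramGen z₀ (↥E)
    rw [hr] at h
    exact h
  obtain ⟨θ, -, hθ2⟩ := exists_ringEquiv_of_presentation Z g hg
  have hθ2' : ∀ x, θ (algebraMap k Z.left.functionField x) = algebraMap k (↥E) x :=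
    fun x => RingHom.congr_fun hθ2 x
  let ψ : W.left.functionField →ₐ[k] Z.left.functionField :=
    { toRingHom := θ.symm.toRingHom.comp (algebraMap W.left.functionField (↥E))
      commutes' := fun x => by
        change θ.symm (algebraMap W.left.functionField (↥E) (algebraMap k W.left.functionField x)) =
          algebraMap k Z.left.functionField x
        rw [← IsScalarTower.algebraMap_apply k W.left.functionField (↥E) x, ← hθ2' x,
          RingEquiv.symm_apply_apply] }
  -- the chain over `K(Z)`
  let pZ : Fin (N + 1) → Z.left.functionField := ψ ∘ p
  let qZ : Fin (N + 1) → Z.left.functionField := ψ ∘ q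
  let wZ : ℕ → Fin (N + 1) → Z.left.functionField := fun j l => θ.symm (wE j l)
  have hpZ0 : pZ ≠ 0 := comp_ne_zero ψ hp0
  have hqZ0 : qZ ≠ 0 := comp_ne_zero ψ hq0
  have hwZ0 : wZ 0 = pZ := by
    funext l
    change θ.symm (wE 0 l) = θ.symm (algebraMap W.left.functionField (↥E) (p l))
    rw [hwE0]
    rfl
  have hwZr : wZ (r + 1) = qZ := by
    funext l
    change θ.symm (wE (r + 1) l) = θ.symm (algebraMap W.left.functionField (↥E) (q l))
    rw [hwEr]
    rfl
  have hwZne : ∀ j ≤ r + 1, wZ j ≠ 0 := fun j hj h0 => hwEne j hj (by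
    funext l
    have hl : θ.symm (wE j l) = 0 := congrFun h0 l
    exact θ.symm.injective (hl.trans (map_zero θ.symm).symm))
  have hmapθ : ∀ b, MvPolynomial.map θ.toRingHom
      (MvPolynomial.map (algebraMap k Z.left.functionField) (F b)) =
      MvPolynomial.map (algebraMap W.left.functionField (↥E))
        (MvPolynomial.map (algebraMap k W.left.functionField) (F b)) := by
    intro b
    rw [MvPolynomial.map_map, MvPolynomial.map_map, hθ2,
      IsScalarTower.algebraMap_eq k W.left.functionField (↥E)]
  have hθw : ∀ j, ⇑θ.toRingHom ∘ wZ j = wE j := fun j => funext fun l => θ.apply_symm_apply _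
  have hrel : ∀ j ≤ r, ∀ b (s t : Z.left.functionField),
      eval (s • wZ j + t • wZ (j + 1)) (MvPolynomial.map (algebraMap k Z.left.functionField) (F b)) =
        0 := by
    intro j hj b s t
    apply θ.toRingHom.injective
    rw [map_zero, ← eval_comp_map θ.toRingHom, comp_smul_add_smul, hmapθ, hθw, hθw]
    exact hwElink j hj b _ _
  have hFw : ∀ j ≤ r + 1, ∀ b,
      eval (wZ j) (MvPolynomial.map (algebraMap k Z.left.functionField) (F b)) = 0 := by
    intro j hj b
    rcases Nat.lt_or_ge j (r + 1) with hlt | hge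
    · have h := hrel j (by omega) b 1 0
      rwa [one_smul, zero_smul, add_zero] at h
    · have hj' : j = r + 1 := le_antisymm hj hge
      obtain ⟨r', hr'⟩ : ∃ r', j = r' + 1 := ⟨r, hj'⟩
      have h := hrel r' (by omega) b 0 1
      rwa [zero_smul, one_smul, zero_add, ← hr'] at h
  -- instances on `X ×ₖ Z`
  haveI : LocallyOfFiniteType (X ⊗ Z).hom :=
    inferInstanceAs (LocallyOfFiniteType (pullback.fst X.hom Z.hom ≫ X.hom))
  haveI : IsProper (CartesianMonoidalCategory.fst X Z).left :=
    inferInstanceAs (IsProper (pullback.fst X.hom Z.hom))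
  haveI : QuasiCompact (X ⊗ Z).hom :=
    inferInstanceAs (QuasiCompact (pullback.fst X.hom Z.hom ≫ X.hom))
  haveI : CompactSpace ↥(X ⊗ Z).left := compactSpace_of_quasiCompact_hom (X ⊗ Z)
  haveI : LocallyOfFiniteType ((CartesianMonoidalCategory.fst X Z).left ≫ X.hom) :=
    inferInstanceAs (LocallyOfFiniteType (X ⊗ Z).hom)
  haveI : LocallyOfFiniteType (CartesianMonoidalCategory.fst X Z).left :=
    inferInstanceAs (LocallyOfFiniteType (pullback.fst X.hom Z.hom))
  haveI := infinite_functionField (k := k) Z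
  have hP := isPullback_ιX Z X
  have hi := range_qgen Z
  have hinjK : Function.Injective (iK N Z X i).base := (iK N Z X i).isClosedEmbedding.injective
  -- points of `X_{K(Z)}` with rational coordinates: dimension of their closure in `X × Z`
  have hh1 : ∀ (u : ↥(XK Z X)) (v : Fin (N + 1) → Z.left.functionField) (hv : v ≠ 0),
      (iK N Z X i).base u = (pointOfVec Z.left.functionField v hv).pt →
        height ((ιX Z X).base u) = 1 := by
    intro u v hv hu
    let V : ClosedSubvariety (XK Z X) := ClosedSubvariety.ofPoint _ u
    have hdim := dim_image_eq hP hi hZ1 V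
    have hV : V.dim = 0 := by
      change height V.genericPoint = 0
      rw [ClosedSubvariety.genericPoint_ofPoint, ← height_base_eq_of_isClosedImmersion' (iK N Z X i),
        hu]
      exact height_pt _
    have hI : (V.image (ιX Z X)).dim = height ((ιX Z X).base u) := by
      change height (V.image (ιX Z X)).genericPoint = _
      rw [ClosedSubvariety.genericPoint_image, ClosedSubvariety.genericPoint_ofPoint]
    rw [← hI, hdim, hV]
    rfl
  have hfst_p : ∀ u : ↥(XK Z X),
      (iK N Z X i).base u = (pointOfVec Z.left.functionField pZ hpZ0).pt →
      (CartesianMonoidalCategory.fst X Z).left.base ((ιX Z X).base u) = z₀ := by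
    intro u hu
    apply i.left.isClosedEmbedding.injective
    rw [i_fst_ιX_eq_pt_pointOfVec Z X i ψ p hp0 u hu, hip]
  have hfst_q : ∀ u : ↥(XK Z X),
      (iK N Z X i).base u = (pointOfVec Z.left.functionField qZ hqZ0).pt →
      (CartesianMonoidalCategory.fst X Z).left.base ((ιX Z X).base u) = x₀ := by
    intro u hu
    apply i.left.isClosedEmbedding.injective
    rw [i_fst_ιX_eq_pt_pointOfVec Z X i ψ q hq0 u hu, hiq]
  -- push-forward along `pr₁ : X × Z → X`
  let M : AlgebraicCycle (X ⊗ Z).left ℤ →+ AlgebraicCycle X.left ℤ :=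
    AddMonoidHom.mk' (AlgebraicCycle.map (CartesianMonoidalCategory.fst X Z).left height height)
      (algebraicCycleMap_add _ height height)
  have hMrat : ∀ c' ∈ ratTrivial (X ⊗ Z).left 1, M c' ∈ ratTrivial X.left 1 :=
    fun c' hc' => map_mem_ratTrivial_holds (d := 1) (CartesianMonoidalCategory.fst X Z) hc'
  have hMp : ∀ u : ↥(XK Z X),
      (iK N Z X i).base u = (pointOfVec Z.left.functionField pZ hpZ0).pt →
      ∃ e : ℕ, e ≠ 0 ∧ M (primeCycle ((ιX Z X).base u)) = (e : ℤ) • primeCycle z₀ := by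
    intro u hu
    refine ⟨AlgebraicCycle.mapCoeff (CartesianMonoidalCategory.fst X Z).left height height
      ((ιX Z X).base u), ?_, ?_⟩
    · exact mapCoeff_ne_zero_of_height_eq (CartesianMonoidalCategory.fst X Z).left X.hom _
        (hh1 u pZ hpZ0 hu) (by rw [hfst_p u hu, hz, Nat.cast_one])
    · change AlgebraicCycle.map (CartesianMonoidalCategory.fst X Z).left height height _ = _
      rw [algebraicCycleMap_primeCycle_eq_nsmul, natCast_zsmul, hfst_p u hu]
  have hMq : ∀ u : ↥(XK Z X),
      (iK N Z X i).base u = (pointOfVec Z.left.functionField qZ hqZ0).pt →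
      M (primeCycle ((ιX Z X).base u)) = 0 := by
    intro u hu
    change AlgebraicCycle.map (CartesianMonoidalCategory.fst X Z).left height height _ = _
    rw [algebraicCycleMap_primeCycle_eq_nsmul]
    have hne : height ((ιX Z X).base u) ≠
        height ((CartesianMonoidalCategory.fst X Z).left.base ((ιX Z X).base u)) := by
      rw [hh1 u qZ hqZ0 hu, hfst_q u hu, hx₀0]; exact one_ne_zero
    rw [AlgebraicCycle.mapCoeff, if_neg hne, zero_smul]
  have key_line : ∀ V : AlgebraicCycle (X ⊗ Z).left ℤ,
      (∀ z, V z ≠ 0 → IsLinePoint N i ((CartesianMonoidalCategory.fst X Z).left.base z)) →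
      ∃ s : Finset ↥X.left, (∀ y ∈ s, IsLinePoint N i y) ∧ Function.support (M V) ⊆ s := by
    intro V hV
    refine ⟨(finite_support_of_compactSpace V).toFinset.image
      (CartesianMonoidalCategory.fst X Z).left.base, ?_, ?_⟩
    · intro y hy
      rw [Finset.mem_image] at hy
      obtain ⟨z, hz', rfl⟩ := hy
      exact hV z (Function.mem_support.mp ((Set.Finite.mem_toFinset _).mp hz'))
    · exact support_map_subset _ V _ (by rw [Set.Finite.coe_toFinset])
  -- reduction to a relation `M c' = e [z₀] + M V` in `X × Z`
  suffices h : ∃ e : ℕ, e ≠ 0 ∧ ∃ c' ∈ ratTrivial (X ⊗ Z).left 1,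
      ∃ V : AlgebraicCycle (X ⊗ Z).left ℤ,
        M c' = (e : ℤ) • primeCycle z₀ + M V ∧
          ∀ z, V z ≠ 0 → IsLinePoint N i ((CartesianMonoidalCategory.fst X Z).left.base z) by
    obtain ⟨e, he, c', hc', V, hMc', hV⟩ := h
    obtain ⟨s, hs, hsupp⟩ := key_line V hV
    refine ⟨e, Nat.pos_of_ne_zero he, s, fun y => -((M V) y), hs, ?_⟩
    change (e : ℤ) • primeCycle z₀ - ∑ y ∈ s, (-((M V) y)) • primeCycle y ∈ ratTrivial X.left 1
    have hsum : ∑ y ∈ s, (-((M V) y)) • primeCycle y = -(M V) := by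
      rw [eq_sum_smul_primeCycle_of_support_subset (-(M V)) (s := s)
        (by rw [Function.locallyFinsuppWithin.coe_neg, Function.support_neg]; exact hsupp)]
      rfl
    rw [hsum, sub_neg_eq_add, ← hMc']
    exact hMrat c' hc'
  -- the points `u_j ∈ X_{K(Z)}` of the chain (indices beyond `r + 1` are clamped)
  have hex : ∀ j, ∃ u : ↥(XK Z X), (iK N Z X i).base u =
      (pointOfVec Z.left.functionField (wZ (min j (r + 1)))
        (hwZne _ (Nat.min_le_right j (r + 1)))).pt := fun j =>
    pt_pointOfVec_mem_range_iK X i Z F d hFhom hd hrange _ _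
      (hFw _ (Nat.min_le_right j (r + 1)))
  choose u hu using hex
  let T : ℕ → AlgebraicCycle (X ⊗ Z).left ℤ := fun j => primeCycle ((ιX Z X).base (u j))
  -- one relation per link
  have hlinkrel : ∀ j : Fin (r + 1), ∃ c' ∈ ratTrivial (X ⊗ Z).left 1,
      ∃ V : AlgebraicCycle (X ⊗ Z).left ℤ, c' = T j - T ((j : ℕ) + 1) + V ∧
        ∀ z, V z ≠ 0 → IsLinePoint N i ((CartesianMonoidalCategory.fst X Z).left.base z) := by
    intro j
    have hj : (j : ℕ) ≤ r := Nat.lt_succ_iff.mp j.2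
    have hminj : min (j : ℕ) (r + 1) = j := Nat.min_eq_left (by omega)
    have hminj1 : min ((j : ℕ) + 1) (r + 1) = (j : ℕ) + 1 := Nat.min_eq_left (by omega)
    have huj : (iK N Z X i).base (u j) =
        (pointOfVec Z.left.functionField (wZ j) (hwZne _ (by omega))).pt := by
      rw [hu j]; congr 1; simp only [hminj]
    have huj1 : (iK N Z X i).base (u ((j : ℕ) + 1)) =
        (pointOfVec Z.left.functionField (wZ ((j : ℕ) + 1)) (hwZne _ (by omega))).pt := by
      rw [hu ((j : ℕ) + 1)]; congr 1; simp only [hminj1]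
    by_cases hind : LinearIndependent Z.left.functionField ![wZ j, wZ ((j : ℕ) + 1)]
    · obtain ⟨c', hc', uX, huX, V, hcV, hV⟩ := exists_relation_of_line Z X i hN hZ1 hpid F hrange
        ![wZ j, wZ ((j : ℕ) + 1)] hind (fun b s t => hrel j hj b s t)
      have h0 : uX 0 = u j := hinjK (by rw [huX 0, huj]; rfl)
      have h1 : uX 1 = u ((j : ℕ) + 1) := hinjK (by rw [huX 1, huj1]; rfl)
      exact ⟨c', hc', V, by rw [hcV, h0, h1], hV⟩
    · -- proportional consecutive vectors: the two points coincide
      obtain ⟨c₀, hc₀, hwc⟩ := exists_eq_smul_of_not_linearIndependent (hwZne _ (by omega))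
        (hwZne _ (by omega)) hind
      have heq : pointOfVec Z.left.functionField (wZ j) (hwZne _ (by omega)) =
          pointOfVec Z.left.functionField (wZ ((j : ℕ) + 1)) (hwZne _ (by omega)) :=
        (pointOfVec_eq_pointOfVec_iff _ _ _ _).mpr ⟨c₀, hc₀, hwc⟩
      have hujj : u j = u ((j : ℕ) + 1) :=
        hinjK (by rw [huj, huj1]; exact congrArg AlgPoints.pt heq)
      refine ⟨0, zero_mem _, 0, ?_, fun z hz0 => (hz0 rfl).elim⟩
      simp only [T, hujj, sub_self, add_zero]
  choose cf hcf Vf hcV hVf using hlinkrel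
  -- telescoping
  have htel : ∑ j : Fin (r + 1), (T j - T ((j : ℕ) + 1)) = T 0 - T (r + 1) := by
    rw [Fin.sum_univ_eq_sum_range (fun n => T n - T (n + 1)) (r + 1)]
    exact Finset.sum_range_sub' T (r + 1)
  have hu0 : (iK N Z X i).base (u 0) = (pointOfVec Z.left.functionField pZ hpZ0).pt := by
    rw [hu 0]; congr 1; simp only [Nat.zero_min, hwZ0]
  have hur : (iK N Z X i).base (u (r + 1)) = (pointOfVec Z.left.functionField qZ hqZ0).pt := by
    rw [hu (r + 1)]; congr 1; simp only [min_self, hwZr]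
  obtain ⟨e, he, hMe⟩ := hMp (u 0) hu0
  refine ⟨e, he, ∑ j, cf j, sum_mem fun j _ => hcf j, ∑ j, Vf j, ?_, fun z hz' => ?_⟩
  · have hsum : ∑ j, cf j = (∑ j : Fin (r + 1), (T j - T ((j : ℕ) + 1))) + ∑ j, Vf j := by
      rw [← Finset.sum_add_distrib]
      exact Finset.sum_congr rfl fun j _ => hcV j
    rw [hsum, htel, map_add, map_sub]
    change M (primeCycle _) - M (primeCycle _) + _ = _
    rw [hMe, hMq (u (r + 1)) hur, sub_zero]
  · have hz'' : (∑ j, Vf j) z ≠ 0 := hz'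
    rw [Function.locallyFinsuppWithin.coe_sum, Finset.sum_apply] at hz''
    obtain ⟨j, -, hj⟩ := Finset.exists_ne_zero_of_sum_ne_zero hz''
    exact hVf j z hj

end MainChain

/-! ## Lines between lines: the algebra of three-line chains -/

section Algebra

variable {K : Type u} [Field K] {N : ℕ}

/-! ### Evaluation of linear forms is linear -/

/-- A linear form evaluates linearly: `ℓ(a y + b y') = a ℓ(y) + b ℓ(y')`. [folklore] -/
theorem eval_add_smul_of_isHomogeneous_one {ℓ : MvPolynomial (Fin (N + 1)) K}
    (hℓ : ℓ.IsHomogeneous 1) (a b : K) (y y' : Fin (N + 1) → K) :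
    eval (a • y + b • y') ℓ = a * eval y ℓ + b * eval y' ℓ := by
  have key : ∀ v : Fin (N + 1) → K, eval v ℓ = ∑ j, coeff (Finsupp.single j 1) ℓ * v j := by
    intro v
    conv_lhs => rw [eq_lin_of_isHomogeneous_one hℓ]
    simp only [lin, map_sum, smul_eval, eval_X]
  rw [key, key y, key y', Finset.mul_sum, Finset.mul_sum, ← Finset.sum_add_distrib]
  refine Finset.sum_congr rfl fun j _ => ?_
  simp only [Pi.add_apply, Pi.smul_apply, smul_eq_mul]
  ring

/-! ### Level sums of a bihomogeneous polynomial and the refined verification step -/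

section Levels

variable {u : ℕ}

/-- The `e`-th level sum of `P ∈ (K[y])[s]` at `s := c`, `y := v`:
`Σ_{|α| = e} c^α · (coeff_α P)(v)`. [folklore] -/
def levelSum (P : MvPolynomial (Fin u) (MvPolynomial (Fin (N + 1)) K)) (e : ℕ) (c : Fin u → K)
    (v : Fin (N + 1) → K) : K :=
  ∑ α ∈ P.support with α.degree = e, (∏ j, c j ^ α j) * eval v (coeff α P)

/-- Unfolding of `levelSum` (`rfl`). [folklore] -/
theorem levelSum_def (P : MvPolynomial (Fin u) (MvPolynomial (Fin (N + 1)) K)) (e : ℕ)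
    (c : Fin u → K) (v : Fin (N + 1) → K) :
    levelSum P e c v = ∑ α ∈ P.support with α.degree = e, (∏ j, c j ^ α j) * eval v (coeff α P) :=
  rfl

/-- **Refined verification step.** If `P ∈ (K[y])[s]` is bihomogeneous of degree `d` and all level
sums of degree `< d` vanish at `(c, v)`, then `P(s := c)(y := t v)` does not depend on `t`
(only the level `d`, with constant coefficients, survives). [folklore] -/
theorem eval_eval_smul_eq_of_levelSum_eq_zero {d : ℕ}
    {P : MvPolynomial (Fin u) (MvPolynomial (Fin (N + 1)) K)}
    (hP : ∀ α, (coeff α P).IsHomogeneous (d - α.degree) ∧ (d < α.degree → coeff α P = 0))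
    {c : Fin u → K} {v : Fin (N + 1) → K} (hv : ∀ e < d, levelSum P e c v = 0) (t : K) :
    eval (t • v) (eval (fun j => C (c j)) P) =
      eval (0 : Fin (N + 1) → K) (eval (fun j => C (c j)) P) := by
  classical
  rw [eval_eval_eq_sum, eval_eval_eq_sum]
  -- both sides, summed level by level
  have hdeg : ∀ α ∈ P.support, α.degree ∈ Finset.range (d + 1) := by
    intro α hα
    rw [Finset.mem_range]
    by_contra h
    exact (mem_support_iff.mp hα) ((hP α).2 (by omega))
  rw [← Finset.sum_fiberwise_of_maps_to hdeg, ← Finset.sum_fiberwise_of_maps_to hdeg]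
  refine Finset.sum_congr rfl fun e he => ?_
  rw [Finset.mem_range] at he
  rcases Nat.lt_or_ge e d with hlt | hge
  · -- a level `< d`: both sides vanish
    have h1 : ∑ α ∈ P.support with α.degree = e, (∏ j, c j ^ α j) * eval (t • v) (coeff α P) =
        t ^ (d - e) * levelSum P e c v := by
      rw [levelSum_def, Finset.mul_sum]
      refine Finset.sum_congr rfl fun α hα => ?_
      rw [(Finset.mem_filter.mp hα).2.symm, eval_smul_of_isHomogeneous (hP α).1]
      ring
    have h2 : ∑ α ∈ P.support with α.degree = e, (∏ j, c j ^ α j) *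
        eval (0 : Fin (N + 1) → K) (coeff α P) = (0 : K) ^ (d - e) * levelSum P e c v := by
      rw [levelSum_def, Finset.mul_sum]
      refine Finset.sum_congr rfl fun α hα => ?_
      rw [(Finset.mem_filter.mp hα).2.symm,
        show (0 : Fin (N + 1) → K) = (0 : K) • v from (zero_smul K v).symm,
        eval_smul_of_isHomogeneous (hP α).1]
      ring
    rw [h1, h2, hv e hlt, mul_zero, mul_zero]
  · -- the top level: constant coefficients
    have hed : e = d := by omega
    refine Finset.sum_congr rfl fun α hα => ?_
    have hαd : α.degree = d := by rw [(Finset.mem_filter.mp hα).2, hed]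
    rw [eval_smul_of_isHomogeneous (hP α).1,
      show (0 : Fin (N + 1) → K) = (0 : K) • v from (zero_smul K v).symm,
      eval_smul_of_isHomogeneous (hP α).1, hαd, Nat.sub_self, pow_zero, pow_zero]

/-- The level `d - 1` of a bihomogeneous `P` of degree `d` is linear in `v` (its coefficients
are linear forms). [folklore] -/
theorem levelSum_add_smul {d : ℕ} {P : MvPolynomial (Fin u) (MvPolynomial (Fin (N + 1)) K)}
    (hP : ∀ α, (coeff α P).IsHomogeneous (d - α.degree) ∧ (d < α.degree → coeff α P = 0))
    (hd : 1 ≤ d) (c : Fin u → K) (a b : K) (y y' : Fin (N + 1) → K) :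
    levelSum P (d - 1) c (a • y + b • y') =
      a * levelSum P (d - 1) c y + b * levelSum P (d - 1) c y' := by
  rw [levelSum_def, levelSum_def, levelSum_def, Finset.mul_sum, Finset.mul_sum,
    ← Finset.sum_add_distrib]
  refine Finset.sum_congr rfl fun α hα => ?_
  have hα1 : (coeff α P).IsHomogeneous 1 := by
    have h := (hP α).1
    rw [(Finset.mem_filter.mp hα).2] at h
    have : d - (d - 1) = 1 := by omega
    rwa [this] at h
  rw [eval_add_smul_of_isHomogeneous_one hα1]
  ring

end Levels

/-! ### The substitution along a frame of two vectors -/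

section Frame

/-- `F(s₀ w₀ + s₁ w₁ + y) ∈ (K[y])[s₀, s₁]`. [folklore] -/
abbrev framePoly (w : Fin 2 → Fin (N + 1) → K) (F : MvPolynomial (Fin (N + 1)) K) :
    MvPolynomial (Fin 2) (MvPolynomial (Fin (N + 1)) K) :=
  aeval (fun m : Fin (N + 1) =>
    (∑ j : Fin 2, C (C (w j m)) * X j) + C (X m) :
      Fin (N + 1) → MvPolynomial (Fin 2) (MvPolynomial (Fin (N + 1)) K)) F

/-- `framePoly` is bihomogeneous of degree `d` for a form of degree `d`. [folklore] -/
theorem isBihom_framePoly (w : Fin 2 → Fin (N + 1) → K) {F : MvPolynomial (Fin (N + 1)) K} {d : ℕ}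
    (hF : F.IsHomogeneous d) :
    ∀ α, (coeff α (framePoly w F)).IsHomogeneous (d - α.degree) ∧
      (d < α.degree → coeff α (framePoly w F) = 0) := by
  refine isBihom_aeval hF _ fun m => ?_
  refine isBihom_add (isBihom_sum _ _ fun j _ => ?_)
    (isBihom_C_of_isHomogeneous_one (isHomogeneous_X K m))
  simpa using isBihom_mul (isBihom_C_C (σ := Fin 2) (τ := Fin (N + 1)) (w j m))
    (isBihom_X (k := K) (τ := Fin (N + 1)) j)

/-- The vector `c₀ w₀ + c₁ w₁` of the frame. [folklore] -/
abbrev frameVec (w : Fin 2 → Fin (N + 1) → K) (c : Fin 2 → K) : Fin (N + 1) → K :=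
  fun m => ∑ j, c j * w j m

/-- **The line between `c₀ w₀ + c₁ w₁` and `v` lies on `V(F)`** as soon as all level sums of
degree `< d` of `F(s₀ w₀ + s₁ w₁ + y)` vanish at `(c, v)` and `F` vanishes at `c₀ w₀ + c₁ w₁`.
[folklore] -/
theorem eval_smul_frameVec_add_smul_eq_zero {F : MvPolynomial (Fin (N + 1)) K} {d : ℕ}
    (hF : F.IsHomogeneous d) (hd : 0 < d) (w : Fin 2 → Fin (N + 1) → K) {c : Fin 2 → K}
    {v : Fin (N + 1) → K} (hlev : ∀ e < d, levelSum (framePoly w F) e c v = 0)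
    (hFc : eval (frameVec w c) F = 0) (s t : K) :
    eval (s • frameVec w c + t • v) F = 0 := by
  -- `F(m₁ + t v) = F(m₁) = 0` for all `t`
  have hline : ∀ t' : K, eval (frameVec w c + t' • v) F = 0 := by
    intro t'
    have key := eval_eval_smul_eq_of_levelSum_eq_zero (isBihom_framePoly w hF) hlev t'
    rw [eval_eval_aeval_lin, eval_eval_aeval_lin] at key
    have h1 : (fun m => ∑ j, c j * w j m + (t' • v) m) = frameVec w c + t' • v := by
      funext m; rfl
    have h2 : (fun m => ∑ j, c j * w j m + (0 : Fin (N + 1) → K) m) = frameVec w c := by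
      funext m; simp [frameVec]
    rw [h1, h2, hFc] at key
    exact key
  by_cases hs : s = 0
  · rw [hs, zero_smul, zero_add, eval_smul_of_isHomogeneous hF]
    have h0 := hline 0
    rw [zero_smul, add_zero] at h0
    -- `F(v) = 0`: the level `0` is `F(v)`; but simpler: `F(t v) = t^d F(v)` and `F(m₁ + t v) = 0`
    -- for all `t` gives, dividing… instead use the level-zero hypothesis directly
    have hv0 : eval v F = 0 := by
      classical
      have hl := hlev 0 hd
      rw [levelSum_def] at hl
      have hsub : ((framePoly w F).support.filter fun α => α.degree = 0) ⊆ {0} := by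
        intro α hα
        rw [Finset.mem_singleton]
        exact (Finsupp.degree_eq_zero_iff α).mp (Finset.mem_filter.mp hα).2
      rcases Finset.subset_singleton_iff.mp hsub with hemp | hsing
      · -- `0 ∉ support`: the constant coefficient vanishes
        have hc0 : coeff 0 (framePoly w F) = 0 := by
          by_contra hne
          have hmem : (0 : Fin 2 →₀ ℕ) ∈ (framePoly w F).support.filter fun α => α.degree = 0 :=
            Finset.mem_filter.mpr ⟨mem_support_iff.mpr hne, by simp⟩
          rw [hemp] at hmem
          exact (Finset.notMem_empty _ hmem)
        have key := eval_eval_aeval_lin w F 0 v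
        rw [show (fun j : Fin 2 => C ((0 : Fin 2 → K) j)) =
          fun _ => (0 : MvPolynomial (Fin (N + 1)) K) from funext fun _ => by simp,
          show (fun _ : Fin 2 => (0 : MvPolynomial (Fin (N + 1)) K)) = 0 from rfl,
          eval_zero, constantCoeff_eq, hc0, map_zero] at key
        have hv' : (fun m => ∑ j, (0 : Fin 2 → K) j * w j m + v m) = v := by funext m; simp
        rw [hv'] at key
        exact key.symm
      · rw [hsing, Finset.sum_singleton] at hl
        simp only [Finsupp.coe_zero, Pi.zero_apply, pow_zero, Finset.prod_const_one, one_mul] at hl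
        have key := eval_eval_aeval_lin w F 0 v
        rw [show (fun j : Fin 2 => C ((0 : Fin 2 → K) j)) =
          fun _ => (0 : MvPolynomial (Fin (N + 1)) K) from funext fun _ => by simp,
          show (fun _ : Fin 2 => (0 : MvPolynomial (Fin (N + 1)) K)) = 0 from rfl,
          eval_zero, constantCoeff_eq, hl] at key
        have hv' : (fun m => ∑ j, (0 : Fin 2 → K) j * w j m + v m) = v := by funext m; simp
        rw [hv'] at key
        exact key.symm
    rw [hv0, mul_zero]
  · have h := hline (t / s)
    have hvec : s • frameVec w c + t • v = s • (frameVec w c + (t / s) • v) := by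
      rw [smul_add, smul_smul, mul_div_cancel₀ t hs]
    rw [hvec, eval_smul_of_isHomogeneous hF, h, mul_zero]

end Frame

/-! ### Level polynomials in the frame parameters -/

section LevelPoly

variable {u : ℕ}

/-- The level `e` as a form in the parameters `s`: `Σ_{|α| = e} (coeff_α P)(y) · s^α ∈ K[s]`.
[folklore] -/
def levelPoly (P : MvPolynomial (Fin u) (MvPolynomial (Fin (N + 1)) K)) (e : ℕ)
    (y : Fin (N + 1) → K) : MvPolynomial (Fin u) K :=
  ∑ α ∈ P.support with α.degree = e, monomial α (eval y (coeff α P))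

/-- `levelPoly` evaluates to the level sum. [folklore] -/
theorem eval_levelPoly (P : MvPolynomial (Fin u) (MvPolynomial (Fin (N + 1)) K)) (e : ℕ)
    (y : Fin (N + 1) → K) (c : Fin u → K) : eval c (levelPoly P e y) = levelSum P e c y := by
  rw [levelPoly, map_sum, levelSum_def]
  refine Finset.sum_congr rfl fun α _ => ?_
  rw [eval_monomial, Finsupp.prod_fintype _ _ (fun i => by rw [pow_zero]), mul_comm]

/-- `levelPoly P e y` is a form of degree `e`. [folklore] -/
theorem isHomogeneous_levelPoly (P : MvPolynomial (Fin u) (MvPolynomial (Fin (N + 1)) K)) (e : ℕ)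
    (y : Fin (N + 1) → K) : (levelPoly P e y).IsHomogeneous e := by
  refine IsHomogeneous.sum _ _ _ fun α hα => ?_
  exact isHomogeneous_monomial _ (Finset.mem_filter.mp hα).2

/-- The level `0` of `framePoly w F` at `v` vanishes when `F(v) = 0`. [folklore] -/
theorem levelSum_framePoly_zero (w : Fin 2 → Fin (N + 1) → K) (F : MvPolynomial (Fin (N + 1)) K)
    (c : Fin 2 → K) {v : Fin (N + 1) → K} (hFv : eval v F = 0) :
    levelSum (framePoly w F) 0 c v = 0 := by
  classical
  have h0 : eval v (coeff 0 (framePoly w F)) = eval v F := by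
    have key := eval_eval_aeval_lin w F 0 v
    rw [show (fun j : Fin 2 => C ((0 : Fin 2 → K) j)) =
      fun _ => (0 : MvPolynomial (Fin (N + 1)) K) from funext fun _ => by simp,
      show (fun _ : Fin 2 => (0 : MvPolynomial (Fin (N + 1)) K)) = 0 from rfl,
      eval_zero, constantCoeff_eq] at key
    have hv' : (fun m => ∑ j, (0 : Fin 2 → K) j * w j m + v m) = v := by funext m; simp
    rw [hv'] at key
    exact key
  rw [levelSum_def]
  refine Finset.sum_eq_zero fun α hα => ?_
  obtain rfl : α = 0 := (Finsupp.degree_eq_zero_iff α).mp (Finset.mem_filter.mp hα).2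
  rw [h0, hFv, mul_zero]

/-- Evaluating after substituting polynomials: `(G(M))(c) = G(M(c))`. [folklore] -/
theorem eval_aeval_eq_eval {τ : Type*} (M : Fin (N + 1) → MvPolynomial τ K)
    (G : MvPolynomial (Fin (N + 1)) K) (c : τ → K) :
    eval c (aeval M G) = eval (fun m => eval c (M m)) G := by
  rw [MvPolynomial.aeval_eq_bind₁, show eval c (bind₁ M G) = eval₂Hom (RingHom.id K) c (bind₁ M G)
    from rfl, eval₂Hom_bind₁]
  rfl

end LevelPoly

/-! ### A line between two lines of a cubic hypersurface -/

section Cubic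

variable [IsAlgClosed K]

omit [IsAlgClosed K] in
/-- `frameVec z c' = c'₀ z₀ + c'₁ z₁`. [folklore] -/
theorem frameVec_eq_add_smul (z : Fin 2 → Fin (N + 1) → K) (c' : Fin 2 → K) :
    frameVec z c' = c' 0 • z 0 + c' 1 • z 1 := by
  funext m
  simp [frameVec, Fin.sum_univ_two]

omit [IsAlgClosed K] in
/-- `frameVec w c ≠ 0` for `c ≠ 0` and an independent frame. [folklore] -/
theorem frameVec_ne_zero {w : Fin 2 → Fin (N + 1) → K} (hw : LinearIndependent K w)
    {c : Fin 2 → K} (hc : c ≠ 0) : frameVec w c ≠ 0 := by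
  intro h0
  apply hc
  have h := Fintype.linearIndependent_iff.mp hw c (by
    funext m
    have hm := congrFun h0 m
    simpa [frameVec, Finset.sum_apply, Pi.smul_apply, smul_eq_mul] using hm)
  funext j
  exact h j

/-- A binary form of positive degree over an algebraically closed field has a non-trivial zero.
[folklore] -/
theorem exists_ne_zero_eval_eq_zero_of_isHomogeneous {Φ : MvPolynomial (Fin 2) K} {e : ℕ}
    (hΦ : Φ.IsHomogeneous e) (he : 0 < e) : ∃ c : Fin 2 → K, c ≠ 0 ∧ eval c Φ = 0 := by
  obtain ⟨c, hc0, hc⟩ := (isCrSystem_zero_of_isAlgClosed K).exists_common_zero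
    (f := fun _ : Fin 1 => Φ) (d := fun _ => e) (fun _ => he) (fun _ => hΦ) (by simp)
  exact ⟨c, hc0, hc 0⟩

/-- **A line of a cubic hypersurface joining two of its lines.** Let `F` be a cubic form on
`Kᴺ⁺¹`, `K` algebraically closed, vanishing identically on the planes `span(w₀, w₁)` and
`span(z₀, z₁)` (two lines `ℓ₁, ℓ₂` of `V₊(F)`). Then there are points `m₁ ∈ ℓ₁`, `m₂ ∈ ℓ₂` with
`F` vanishing on `span(m₁, m₂)`: any two lines of a cubic hypersurface are joined by a line (so any
two points by a chain of three lines, when every point lies on a line). The conditions on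
`(m₁, m₂) = (c₀ w₀ + c₁ w₁, c'₀ z₀ + c'₁ z₁)` are the `s`-levels `1` and `2` of
`F(s₀ w₀ + s₁ w₁ + m₂)`: the level `2` is linear in `m₂`, so it is solved on `ℓ₂` by
`m₂(c) = E₂(c, z₁) z₀ - E₂(c, z₀) z₁`, and then the level `1` becomes a binary quintic form in `c`,
which has a zero. [folklore] -/
theorem exists_line_between_lines_of_cubic {F : MvPolynomial (Fin (N + 1)) K} (hF : F.IsHomogeneous 3)
    {w z : Fin 2 → Fin (N + 1) → K}
    (hFw : ∀ c : Fin 2 → K, eval (frameVec w c) F = 0)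
    (hFz : ∀ c : Fin 2 → K, eval (frameVec z c) F = 0) :
    ∃ c c' : Fin 2 → K, c ≠ 0 ∧ c' ≠ 0 ∧
      ∀ s t : K, eval (s • frameVec w c + t • frameVec z c') F = 0 := by
  classical
  set P := framePoly w F with hPdef
  have hP := isBihom_framePoly w hF
  -- the conclusion from the level conditions
  have conclude : ∀ c c' : Fin 2 → K, c ≠ 0 → c' ≠ 0 → levelSum P 1 c (frameVec z c') = 0 →
      levelSum P 2 c (frameVec z c') = 0 →
      ∃ c c' : Fin 2 → K, c ≠ 0 ∧ c' ≠ 0 ∧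
        ∀ s t : K, eval (s • frameVec w c + t • frameVec z c') F = 0 := by
    intro c c' hc hc' h1 h2
    refine ⟨c, c', hc, hc', fun s t => eval_smul_frameVec_add_smul_eq_zero hF three_pos w ?_ (hFw c) s t⟩
    intro e he
    interval_cases e
    · exact levelSum_framePoly_zero w F c (hFz c')
    · exact h1
    · exact h2
  -- the level `2` is linear in `m₂`: `E₂(c, y)`
  have hlin : ∀ (c : Fin 2 → K) (a b : K) (y y' : Fin (N + 1) → K),
      levelSum P 2 c (a • y + b • y') = a * levelSum P 2 c y + b * levelSum P 2 c y' :=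
    fun c a b y y' => levelSum_add_smul hP (by norm_num) c a b y y'
  -- the quintic: level `1` at `m₂(c) = E₂(c, z₁) z₀ - E₂(c, z₀) z₁`
  let M : Fin (N + 1) → MvPolynomial (Fin 2) K := fun m =>
    levelPoly P 2 (z 1) * C (z 0 m) - levelPoly P 2 (z 0) * C (z 1 m)
  have hM : ∀ m, (M m).IsHomogeneous 2 := fun m => by
    have h1 := (isHomogeneous_levelPoly P 2 (z 1)).mul (isHomogeneous_C (Fin 2) (z 0 m))
    have h2 := (isHomogeneous_levelPoly P 2 (z 0)).mul (isHomogeneous_C (Fin 2) (z 1 m))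
    rw [add_zero] at h1 h2
    exact h1.sub h2
  let c'of : (Fin 2 → K) → Fin 2 → K := fun c => ![levelSum P 2 c (z 1), -levelSum P 2 c (z 0)]
  have hMeval : ∀ c m, eval c (M m) = frameVec z (c'of c) m := fun c m => by
    simp only [M, map_sub, map_mul, eval_C, eval_levelPoly, frameVec, Fin.sum_univ_two, c'of,
      Matrix.cons_val_zero, Matrix.cons_val_one]
    ring
  let Φ : MvPolynomial (Fin 2) K :=
    ∑ α ∈ P.support with α.degree = 1, monomial α 1 * aeval M (coeff α P)
  have hΦ : Φ.IsHomogeneous 5 := by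
    refine IsHomogeneous.sum _ _ _ fun α hα => ?_
    have hα1 : α.degree = 1 := (Finset.mem_filter.mp hα).2
    have hcoeff : (coeff α P).IsHomogeneous 2 := by
      have h := (hP α).1; rwa [hα1] at h
    have hmon : (monomial α (1 : K)).IsHomogeneous 1 := isHomogeneous_monomial _ hα1
    have hsub : (aeval M (coeff α P)).IsHomogeneous (2 * 2) := hcoeff.aeval M hM
    exact hmon.mul hsub
  have hΦeval : ∀ c, eval c Φ = levelSum P 1 c (frameVec z (c'of c)) := fun c => by
    simp only [Φ, map_sum, map_mul, eval_monomial, one_mul, eval_aeval_eq_eval, hMeval]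
    rw [levelSum_def]
    refine Finset.sum_congr rfl fun α _ => ?_
    rw [Finsupp.prod_fintype _ _ (fun i => by rw [pow_zero])]
  obtain ⟨c, hc0, hcΦ⟩ := exists_ne_zero_eval_eq_zero_of_isHomogeneous hΦ (by norm_num)
  by_cases hdeg : c'of c = 0
  · -- degenerate: `E₂(c, ·)` vanishes on `ℓ₂`; solve the level `1` on `ℓ₂` directly
    have hz0 : levelSum P 2 c (z 0) = 0 := by
      have h := congrFun hdeg 1
      simp only [c'of, Matrix.cons_val_one, Matrix.cons_val_zero, Pi.zero_apply, neg_eq_zero] at h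
      exact h
    have hz1 : levelSum P 2 c (z 1) = 0 := by
      have h := congrFun hdeg 0
      simpa [c'of] using h
    let L : Fin (N + 1) → MvPolynomial (Fin 2) K := fun m => C (z 0 m) * X 0 + C (z 1 m) * X 1
    have hL : ∀ m, (L m).IsHomogeneous 1 := fun m =>
      ((isHomogeneous_C (Fin 2) (z 0 m)).mul (isHomogeneous_X K 0)).add
        ((isHomogeneous_C (Fin 2) (z 1 m)).mul (isHomogeneous_X K 1))
    have hLeval : ∀ (c' : Fin 2 → K) m, eval c' (L m) = frameVec z c' m := fun c' m => by
      simp only [L, map_add, map_mul, eval_C, eval_X, frameVec, Fin.sum_univ_two]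
      ring
    let Ψ : MvPolynomial (Fin 2) K :=
      ∑ α ∈ P.support with α.degree = 1, C (∏ j, c j ^ α j) * aeval L (coeff α P)
    have hΨ : Ψ.IsHomogeneous 2 := by
      refine IsHomogeneous.sum _ _ _ fun α hα => ?_
      have hα1 : α.degree = 1 := (Finset.mem_filter.mp hα).2
      have hcoeff : (coeff α P).IsHomogeneous 2 := by
        have h := (hP α).1; rwa [hα1] at h
      have hsub : (aeval L (coeff α P)).IsHomogeneous (1 * 2) := hcoeff.aeval L hL
      rw [one_mul] at hsub
      have h := (isHomogeneous_C (Fin 2) (∏ j, c j ^ α j)).mul hsub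
      rwa [zero_add] at h
    have hΨeval : ∀ c', eval c' Ψ = levelSum P 1 c (frameVec z c') := fun c' => by
      simp only [Ψ, map_sum, map_mul, eval_C, eval_aeval_eq_eval, hLeval]
      rfl
    obtain ⟨c', hc'0, hc'Ψ⟩ := exists_ne_zero_eval_eq_zero_of_isHomogeneous hΨ two_pos
    refine conclude c c' hc0 hc'0 (by rw [← hΨeval]; exact hc'Ψ) ?_
    rw [frameVec_eq_add_smul, hlin, hz0, hz1, mul_zero, mul_zero, add_zero]
  · -- generic: `m₂(c) ≠ 0`
    refine conclude c (c'of c) hc0 hdeg (by rw [← hΦeval]; exact hcΦ) ?_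
    rw [frameVec_eq_add_smul, hlin]
    simp only [c'of, Matrix.cons_val_zero, Matrix.cons_val_one]
    ring

end Cubic

/-! ### A line between two lines of an intersection of two quadrics -/

section TwoQuadrics

variable [IsAlgClosed K]

/-- **A line of an intersection of two quadrics joining two of its lines.** Let `F₁, F₂` be
quadratic forms on `Kᴺ⁺¹`, `K` algebraically closed, both vanishing identically on the planes
`span(w₀, w₁)` and `span(z₀, z₁)`. Then there are `m₁ = c₀ w₀ + c₁ w₁`, `m₂ = c'₀ z₀ + c'₁ z₁`
(`c, c' ≠ 0`) with `F₁, F₂` vanishing on `span(m₁, m₂)`. The conditions are the `s`-levels `1`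
of `F_a(s₀ w₀ + s₁ w₁ + m₂)`, both bilinear: the first is solved on `ℓ₂` by
`m₂(c) = E(c, z₁) z₀ - E(c, z₀) z₁`, and the second becomes a binary quadratic form in `c`.
[folklore] -/
theorem exists_line_between_lines_of_two_quadrics {F₁ F₂ : MvPolynomial (Fin (N + 1)) K}
    (hF₁ : F₁.IsHomogeneous 2) (hF₂ : F₂.IsHomogeneous 2) {w z : Fin 2 → Fin (N + 1) → K}
    (hFw : ∀ c : Fin 2 → K, eval (frameVec w c) F₁ = 0 ∧ eval (frameVec w c) F₂ = 0)
    (hFz : ∀ c : Fin 2 → K, eval (frameVec z c) F₁ = 0 ∧ eval (frameVec z c) F₂ = 0) :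
    ∃ c c' : Fin 2 → K, c ≠ 0 ∧ c' ≠ 0 ∧
      ∀ s t : K, eval (s • frameVec w c + t • frameVec z c') F₁ = 0 ∧
        eval (s • frameVec w c + t • frameVec z c') F₂ = 0 := by
  classical
  set P₁ := framePoly w F₁ with hP₁def
  set P₂ := framePoly w F₂ with hP₂def
  have hP₁ := isBihom_framePoly w hF₁
  have hP₂ := isBihom_framePoly w hF₂
  -- the conclusion from the level conditions
  have conclude : ∀ c c' : Fin 2 → K, c ≠ 0 → c' ≠ 0 → levelSum P₁ 1 c (frameVec z c') = 0 →
      levelSum P₂ 1 c (frameVec z c') = 0 →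
      ∃ c c' : Fin 2 → K, c ≠ 0 ∧ c' ≠ 0 ∧
        ∀ s t : K, eval (s • frameVec w c + t • frameVec z c') F₁ = 0 ∧
          eval (s • frameVec w c + t • frameVec z c') F₂ = 0 := by
    intro c c' hc hc' h1 h2
    refine ⟨c, c', hc, hc', fun s t => ⟨?_, ?_⟩⟩
    · refine eval_smul_frameVec_add_smul_eq_zero hF₁ two_pos w ?_ (hFw c).1 s t
      intro e he
      interval_cases e
      · exact levelSum_framePoly_zero w F₁ c (hFz c').1
      · exact h1
    · refine eval_smul_frameVec_add_smul_eq_zero hF₂ two_pos w ?_ (hFw c).2 s t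
      intro e he
      interval_cases e
      · exact levelSum_framePoly_zero w F₂ c (hFz c').2
      · exact h2
  -- the levels `1` are linear in `m₂`
  have hlin₁ : ∀ (c : Fin 2 → K) (a b : K) (y y' : Fin (N + 1) → K),
      levelSum P₁ 1 c (a • y + b • y') = a * levelSum P₁ 1 c y + b * levelSum P₁ 1 c y' :=
    fun c a b y y' => levelSum_add_smul hP₁ (by norm_num) c a b y y'
  -- the quadratic form: the level `1` of `F₂` at `m₂(c) = E₁(c, z₁) z₀ - E₁(c, z₀) z₁`
  let M : Fin (N + 1) → MvPolynomial (Fin 2) K := fun m =>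
    levelPoly P₁ 1 (z 1) * C (z 0 m) - levelPoly P₁ 1 (z 0) * C (z 1 m)
  have hM : ∀ m, (M m).IsHomogeneous 1 := fun m => by
    have h1 := (isHomogeneous_levelPoly P₁ 1 (z 1)).mul (isHomogeneous_C (Fin 2) (z 0 m))
    have h2 := (isHomogeneous_levelPoly P₁ 1 (z 0)).mul (isHomogeneous_C (Fin 2) (z 1 m))
    rw [add_zero] at h1 h2
    exact h1.sub h2
  let c'of : (Fin 2 → K) → Fin 2 → K := fun c => ![levelSum P₁ 1 c (z 1), -levelSum P₁ 1 c (z 0)]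
  have hMeval : ∀ c m, eval c (M m) = frameVec z (c'of c) m := fun c m => by
    simp only [M, map_sub, map_mul, eval_C, eval_levelPoly, frameVec, Fin.sum_univ_two, c'of,
      Matrix.cons_val_zero, Matrix.cons_val_one]
    ring
  let Φ : MvPolynomial (Fin 2) K :=
    ∑ α ∈ P₂.support with α.degree = 1, monomial α 1 * aeval M (coeff α P₂)
  have hΦ : Φ.IsHomogeneous 2 := by
    refine IsHomogeneous.sum _ _ _ fun α hα => ?_
    have hα1 : α.degree = 1 := (Finset.mem_filter.mp hα).2
    have hcoeff : (coeff α P₂).IsHomogeneous 1 := by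
      have h := (hP₂ α).1; rwa [hα1] at h
    have hmon : (monomial α (1 : K)).IsHomogeneous 1 := isHomogeneous_monomial _ hα1
    have hsub : (aeval M (coeff α P₂)).IsHomogeneous (1 * 1) := hcoeff.aeval M hM
    exact hmon.mul hsub
  have hΦeval : ∀ c, eval c Φ = levelSum P₂ 1 c (frameVec z (c'of c)) := fun c => by
    simp only [Φ, map_sum, map_mul, eval_monomial, one_mul, eval_aeval_eq_eval, hMeval]
    rw [levelSum_def]
    refine Finset.sum_congr rfl fun α _ => ?_
    rw [Finsupp.prod_fintype _ _ (fun i => by rw [pow_zero])]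
  obtain ⟨c, hc0, hcΦ⟩ := exists_ne_zero_eval_eq_zero_of_isHomogeneous hΦ two_pos
  -- the level `1` of `F₁` vanishes at `m₂(c)` by antisymmetry
  have hlev₁ : levelSum P₁ 1 c (frameVec z (c'of c)) = 0 := by
    rw [frameVec_eq_add_smul, hlin₁]
    simp only [c'of, Matrix.cons_val_zero, Matrix.cons_val_one]
    ring
  by_cases hdeg : c'of c = 0
  · -- degenerate: `E₁(c, ·)` vanishes on `ℓ₂`; solve the level `1` of `F₂` on `ℓ₂` directly
    have hz0 : levelSum P₁ 1 c (z 0) = 0 := by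
      have h := congrFun hdeg 1
      simp only [c'of, Matrix.cons_val_one, Matrix.cons_val_zero, Pi.zero_apply, neg_eq_zero] at h
      exact h
    have hz1 : levelSum P₁ 1 c (z 1) = 0 := by
      have h := congrFun hdeg 0
      simpa [c'of] using h
    let L : Fin (N + 1) → MvPolynomial (Fin 2) K := fun m => C (z 0 m) * X 0 + C (z 1 m) * X 1
    have hL : ∀ m, (L m).IsHomogeneous 1 := fun m =>
      ((isHomogeneous_C (Fin 2) (z 0 m)).mul (isHomogeneous_X K 0)).add
        ((isHomogeneous_C (Fin 2) (z 1 m)).mul (isHomogeneous_X K 1))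
    have hLeval : ∀ (c' : Fin 2 → K) m, eval c' (L m) = frameVec z c' m := fun c' m => by
      simp only [L, map_add, map_mul, eval_C, eval_X, frameVec, Fin.sum_univ_two]
      ring
    let Ψ : MvPolynomial (Fin 2) K :=
      ∑ α ∈ P₂.support with α.degree = 1, C (∏ j, c j ^ α j) * aeval L (coeff α P₂)
    have hΨ : Ψ.IsHomogeneous 1 := by
      refine IsHomogeneous.sum _ _ _ fun α hα => ?_
      have hα1 : α.degree = 1 := (Finset.mem_filter.mp hα).2
      have hcoeff : (coeff α P₂).IsHomogeneous 1 := by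
        have h := (hP₂ α).1; rwa [hα1] at h
      have hsub : (aeval L (coeff α P₂)).IsHomogeneous (1 * 1) := hcoeff.aeval L hL
      rw [one_mul] at hsub
      have h := (isHomogeneous_C (Fin 2) (∏ j, c j ^ α j)).mul hsub
      rwa [zero_add] at h
    have hΨeval : ∀ c', eval c' Ψ = levelSum P₂ 1 c (frameVec z c') := fun c' => by
      simp only [Ψ, map_sum, map_mul, eval_C, eval_aeval_eq_eval, hLeval]
      rfl
    obtain ⟨c', hc'0, hc'Ψ⟩ := exists_ne_zero_eval_eq_zero_of_isHomogeneous hΨ one_pos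
    refine conclude c c' hc0 hc'0 ?_ (by rw [← hΨeval]; exact hc'Ψ)
    rw [frameVec_eq_add_smul, hlin₁, hz0, hz1, mul_zero, mul_zero, add_zero]
  · -- generic: `m₂(c) ≠ 0`
    exact conclude c (c'of c) hc0 hdeg hlev₁ (by rw [← hΦeval]; exact hcΦ)

end TwoQuadrics

/-! ### Chains of three lines through two points: cubics (`N ≥ 4`) and pairs of quadrics (`N ≥ 5`) -/

section ThreeChains

variable {L : Type u} [Field L] [IsAlgClosed L] {N : ℕ}

omit [Field k] in
/-- All maps `Fin 1 → Fin d` have coordinate sum `≤ d - 1` (the count of the greedy step for one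
vector is `d`). [folklore] -/
theorem card_filter_fin_one_le (d : ℕ) (hd : 0 < d) :
    (Finset.univ.filter (fun f : Fin 1 → Fin d => ∑ j, (f j : ℕ) ≤ d - 1)).card = d := by
  rw [Finset.filter_true_of_mem (fun f _ => by
    rw [Fin.sum_univ_one]; have := (f 0).is_lt; omega)]
  simp

omit [Field k] in
/-- **A line through every zero** of forms `F_a` of degrees `d_a ≥ 1` with `Σ_a d_a + 1 < N + 1`
over an algebraically closed field: a vector `y` independent of `p` with all `F_a` vanishing on
`span(y, p)` (`exists_finCons_forall_eval_eq_zero` with one vector). [folklore] -/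
theorem exists_frame_line_through {ι : Type*} [Fintype ι] {F : ι → MvPolynomial (Fin (N + 1)) L}
    {d : ι → ℕ} (hF : ∀ a, (F a).IsHomogeneous (d a)) (hd : ∀ a, 0 < d a)
    (hcount : ∑ a, d a + 1 < N + 1) {p : Fin (N + 1) → L} (hp0 : p ≠ 0)
    (hp : ∀ a, eval p (F a) = 0) :
    ∃ y : Fin (N + 1) → L, LinearIndependent L ![y, p] ∧
      ∀ a (c : Fin 2 → L), eval (frameVec ![y, p] c) (F a) = 0 := by
  have hw : LinearIndependent L (![p] : Fin 1 → Fin (N + 1) → L) :=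
    linearIndependent_unique_iff.mpr (by simpa using hp0)
  have hvan : ∀ a (c : Fin 1 → L), eval (fun m => ∑ j, c j * (![p] : Fin 1 → _) j m) (F a) = 0 := by
    intro a c
    have hvec : (fun m => ∑ j, c j * (![p] : Fin 1 → Fin (N + 1) → L) j m) = c 0 • p := by
      funext m; simp
    rw [hvec, eval_smul_of_isHomogeneous (hF a), hp a, mul_zero]
  obtain ⟨y, hli, hvan2⟩ := exists_finCons_forall_eval_eq_zero hF hd hw hvan (by
    rw [Finset.sum_congr rfl fun a _ => card_filter_fin_one_le (d a) (hd a)]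
    exact hcount)
  refine ⟨y, ?_, fun a c => ?_⟩
  · exact hli
  · exact hvan2 a c

omit [Field k] [IsAlgClosed L] in
/-- `s p + t (c₀ y + c₁ p)` lies in the plane `span(y, p)`. [folklore] -/
theorem smul_add_smul_frameVec_left (y p : Fin (N + 1) → L) (c : Fin 2 → L) (s t : L) :
    s • p + t • frameVec ![y, p] c = frameVec ![y, p] ![t * c 0, s + t * c 1] := by
  funext m
  simp [frameVec, Fin.sum_univ_two]
  ring

omit [Field k] [IsAlgClosed L] in
/-- `s (c₀ y + c₁ q) + t q` lies in the plane `span(y, q)`. [folklore] -/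
theorem smul_frameVec_add_smul_right (y q : Fin (N + 1) → L) (c : Fin 2 → L) (s t : L) :
    s • frameVec ![y, q] c + t • q = frameVec ![y, q] ![s * c 0, s * c 1 + t] := by
  funext m
  simp [frameVec, Fin.sum_univ_two]
  ring

omit [Field k] [IsAlgClosed L] in
/-- The chain `p, m₁, m₂, q` as a sequence. [folklore] -/
theorem exists_chain_of_three_lines {c : ℕ} {F : Fin c → MvPolynomial (Fin (N + 1)) L}
    {p q m₁ m₂ : Fin (N + 1) → L} (hp0 : p ≠ 0) (hq0 : q ≠ 0) (hm₁ : m₁ ≠ 0) (hm₂ : m₂ ≠ 0)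
    (h01 : ∀ a (s t : L), eval (s • p + t • m₁) (F a) = 0)
    (h12 : ∀ a (s t : L), eval (s • m₁ + t • m₂) (F a) = 0)
    (h23 : ∀ a (s t : L), eval (s • m₂ + t • q) (F a) = 0) :
    ∃ (r : ℕ) (v : ℕ → Fin (N + 1) → L), v 0 = p ∧ v (r + 1) = q ∧ (∀ j ≤ r + 1, v j ≠ 0) ∧
      ∀ j ≤ r, ∀ a (s t : L), eval (s • v j + t • v (j + 1)) (F a) = 0 := by
  refine ⟨2, fun j => if j = 0 then p else if j = 1 then m₁ else if j = 2 then m₂ else q,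
    rfl, rfl, fun j hj => ?_, fun j hj a s t => ?_⟩
  · interval_cases j <;> simpa
  · interval_cases j
    · exact h01 a s t
    · exact h12 a s t
    · exact h23 a s t

/-- **Any two points of a cubic hypersurface `V₊(F) ⊆ ℙᴺ`, `N ≥ 4`, are joined by a chain of
three lines** (over an algebraically closed field): a line through each point
(`exists_frame_line_through`, `3 + 1 < N + 1`) and a line joining the two lines
(`exists_line_between_lines_of_cubic`). [folklore] -/
theorem exists_chain_of_cubic (hN : 4 ≤ N) {F : Fin 1 → MvPolynomial (Fin (N + 1)) L}
    (hF : ∀ a, (F a).IsHomogeneous 3) (p q : Fin (N + 1) → L) (hp0 : p ≠ 0) (hq0 : q ≠ 0)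
    (hp : ∀ a, eval p (F a) = 0) (hq : ∀ a, eval q (F a) = 0) :
    ∃ (r : ℕ) (v : ℕ → Fin (N + 1) → L), v 0 = p ∧ v (r + 1) = q ∧ (∀ j ≤ r + 1, v j ≠ 0) ∧
      ∀ j ≤ r, ∀ a (s t : L), eval (s • v j + t • v (j + 1)) (F a) = 0 := by
  have hd : ∀ a : Fin 1, 0 < (fun _ : Fin 1 => 3) a := fun _ => three_pos
  obtain ⟨y, hy, hFy⟩ := exists_frame_line_through (d := fun _ => 3) hF hd
    (by simp; omega) hp0 hp
  obtain ⟨y', hy', hFy'⟩ := exists_frame_line_through (d := fun _ => 3) hF hd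
    (by simp; omega) hq0 hq
  obtain ⟨c₁, c₂, hc₁, hc₂, hline⟩ := exists_line_between_lines_of_cubic (hF 0)
    (fun c => hFy 0 c) (fun c => hFy' 0 c)
  refine exists_chain_of_three_lines hp0 hq0 (frameVec_ne_zero hy hc₁) (frameVec_ne_zero hy' hc₂)
    (fun a s t => ?_) (fun a s t => ?_) (fun a s t => ?_)
  · rw [smul_add_smul_frameVec_left]; exact hFy a _
  · obtain rfl : a = 0 := Subsingleton.elim a 0
    exact hline s t
  · rw [smul_frameVec_add_smul_right]; exact hFy' a _

/-- **Any two points of an intersection of two quadrics `V₊(F₁, F₂) ⊆ ℙᴺ`, `N ≥ 5`, are joined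
by a chain of three lines** (over an algebraically closed field; `2 + 2 + 1 < N + 1` for the lines
through the points, `exists_line_between_lines_of_two_quadrics` for the middle line). [folklore] -/
theorem exists_chain_of_two_quadrics (hN : 5 ≤ N) {F : Fin 2 → MvPolynomial (Fin (N + 1)) L}
    (hF : ∀ a, (F a).IsHomogeneous 2) (p q : Fin (N + 1) → L) (hp0 : p ≠ 0) (hq0 : q ≠ 0)
    (hp : ∀ a, eval p (F a) = 0) (hq : ∀ a, eval q (F a) = 0) :
    ∃ (r : ℕ) (v : ℕ → Fin (N + 1) → L), v 0 = p ∧ v (r + 1) = q ∧ (∀ j ≤ r + 1, v j ≠ 0) ∧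
      ∀ j ≤ r, ∀ a (s t : L), eval (s • v j + t • v (j + 1)) (F a) = 0 := by
  have hd : ∀ a : Fin 2, 0 < (fun _ : Fin 2 => 2) a := fun _ => two_pos
  obtain ⟨y, hy, hFy⟩ := exists_frame_line_through (d := fun _ => 2) hF hd
    (by simp; omega) hp0 hp
  obtain ⟨y', hy', hFy'⟩ := exists_frame_line_through (d := fun _ => 2) hF hd
    (by simp; omega) hq0 hq
  obtain ⟨c₁, c₂, hc₁, hc₂, hline⟩ := exists_line_between_lines_of_two_quadrics (hF 0) (hF 1)
    (fun c => ⟨hFy 0 c, hFy 1 c⟩) (fun c => ⟨hFy' 0 c, hFy' 1 c⟩)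
  refine exists_chain_of_three_lines hp0 hq0 (frameVec_ne_zero hy hc₁) (frameVec_ne_zero hy' hc₂)
    (fun a s t => ?_) (fun a s t => ?_) (fun a s t => ?_)
  · rw [smul_add_smul_frameVec_left]; exact hFy a _
  · fin_cases a
    · exact (hline s t).1
    · exact (hline s t).2
  · rw [smul_frameVec_add_smul_right]; exact hFy' a _

end ThreeChains

end Algebra

end ProjFamily

/-! ### `CH₁(X)/⟨lines⟩` is torsion, given chains of lines -/

section TorsionChain

open ProjFamily

variable {k : Type u} [Field k] [IsAlgClosed k]

/-- **`CH₁(X)` is generated by lines up to torsion when `X` is chain connected by lines over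
algebraically closed fields** (the first step of the proof of Tian–Zong's Thm. 6.1, product trick
of Prop. 7.1, with the chain connectedness — Kollár V.4.8.1 for `Σ d_a ≤ N - 1` — as hypothesis
`hchain`): every `x ∈ CH₁(X)` has a positive multiple in the subgroup generated by the line
classes. [cite: TianZong2014, Prop. 7.1, proof of Thm. 6.1] -/
theorem exists_pos_smul_mem_closure_lineClasses_of_chain {N : ℕ} (hN : 1 ≤ N) {X : SchemeOver k}
    {c : ℕ} (F : Fin c → MvPolynomial (Fin (N + 1)) k) (d : Fin c → ℕ) (i : X ⟶ projectiveSpace N k)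
    [IsClosedImmersion i.left] (hFhom : ∀ a, (F a).IsHomogeneous (d a)) (hd : ∀ a, 0 < d a)
    (hrange : Set.range i.left.base =
      ProjectiveSpectrum.zeroLocus (homogeneousSubmodule (Fin (N + 1)) k) (Set.range F))
    (hchain : ∀ (L : Type u) [Field L] [IsAlgClosed L] [Algebra k L] (p q : Fin (N + 1) → L),
      p ≠ 0 → q ≠ 0 → (∀ a, eval p (MvPolynomial.map (algebraMap k L) (F a)) = 0) →
      (∀ a, eval q (MvPolynomial.map (algebraMap k L) (F a)) = 0) →
      ∃ (r : ℕ) (v : ℕ → Fin (N + 1) → L), v 0 = p ∧ v (r + 1) = q ∧ (∀ j ≤ r + 1, v j ≠ 0) ∧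
        ∀ j ≤ r, ∀ a (s t : L),
          eval (s • v j + t • v (j + 1)) (MvPolynomial.map (algebraMap k L) (F a)) = 0)
    (x : ChowGroup X.left 1) :
    ∃ e : ℕ, 0 < e ∧ (e : ℤ) • x ∈ AddSubgroup.closure (lineClasses N i) := by
  haveI : IsProper (projectiveSpace N k).hom := isProper_projectiveSpace N k
  haveI : IsProper X.hom := by rw [← Over.w i]; infer_instance
  haveI : CompactSpace ↥X.left := compactSpace_of_quasiCompact_hom X
  suffices h : AddSubgroup.posSmulSaturation (AddSubgroup.closure (lineClasses N i)) = ⊤ by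
    have hx : x ∈ AddSubgroup.posSmulSaturation (AddSubgroup.closure (lineClasses N i)) := by
      rw [h]; exact AddSubgroup.mem_top x
    exact hx
  refine ChowGroup.eq_top_of_forall_ofPoint_mem fun z hz => ?_
  obtain ⟨e, he, s, w, hs, hrat⟩ := exists_pos_smul_primeCycle_ratEquiv_lines_of_chain X i hN F d
    hFhom hd hrange hchain z (by simpa using hz)
  refine ⟨e, he, ?_⟩
  have hmk : (e : ℤ) • ChowGroup.ofPoint z hz =
      ChowGroup.mk X.left 1 ⟨_, sum_zsmul_primeCycle_mem_cyclesOfDim w hs⟩ := by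
    rw [ChowGroup.ofPoint, ← map_zsmul]
    exact ChowGroup.mk_eq_mk_iff.mpr hrat
  rw [hmk]
  exact mk_sum_zsmul_primeCycle_mem_closure_lineClasses w hs

/-- Quotient form: **`CH₁(X)/⟨lines⟩` is a torsion group** when `X` is chain connected by lines
over algebraically closed fields. [cite: TianZong2014, Prop. 7.1, proof of Thm. 6.1] -/
theorem isTorsion_chowGroupOne_quot_lineClasses_of_chain {N : ℕ} (hN : 1 ≤ N) {X : SchemeOver k}
    {c : ℕ} (F : Fin c → MvPolynomial (Fin (N + 1)) k) (d : Fin c → ℕ) (i : X ⟶ projectiveSpace N k)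
    [IsClosedImmersion i.left] (hFhom : ∀ a, (F a).IsHomogeneous (d a)) (hd : ∀ a, 0 < d a)
    (hrange : Set.range i.left.base =
      ProjectiveSpectrum.zeroLocus (homogeneousSubmodule (Fin (N + 1)) k) (Set.range F))
    (hchain : ∀ (L : Type u) [Field L] [IsAlgClosed L] [Algebra k L] (p q : Fin (N + 1) → L),
      p ≠ 0 → q ≠ 0 → (∀ a, eval p (MvPolynomial.map (algebraMap k L) (F a)) = 0) →
      (∀ a, eval q (MvPolynomial.map (algebraMap k L) (F a)) = 0) →
      ∃ (r : ℕ) (v : ℕ → Fin (N + 1) → L), v 0 = p ∧ v (r + 1) = q ∧ (∀ j ≤ r + 1, v j ≠ 0) ∧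
        ∀ j ≤ r, ∀ a (s t : L),
          eval (s • v j + t • v (j + 1)) (MvPolynomial.map (algebraMap k L) (F a)) = 0) :
    AddMonoid.IsTorsion (ChowGroup X.left 1 ⧸ AddSubgroup.closure (lineClasses N i)) := by
  intro y
  induction y using QuotientAddGroup.induction_on with
  | H x =>
    obtain ⟨e, he, hx⟩ := exists_pos_smul_mem_closure_lineClasses_of_chain hN F d i hFhom hd hrange
      hchain x
    refine (isOfFinAddOrder_iff_nsmul_eq_zero).mpr ⟨e, he, ?_⟩
    rw [← QuotientAddGroup.mk_nsmul, QuotientAddGroup.eq_zero_iff, ← natCast_zsmul]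
    exact hx

/-- **`CH₁ ⊗ ℚ` of a cubic hypersurface of dimension `≥ 3` is generated by its lines**: for
`X ⊆ ℙᴺ_k` (`N ≥ 4`, `k` algebraically closed) a closed subscheme with underlying set `V₊(F)`, `F`
a cubic form, every `x ∈ CH₁(X)` has a positive multiple in the subgroup generated by the line
classes — in particular for smooth cubic threefolds, the first case of Tian–Zong's Thm. 1.7 not
covered by `Σ (2 dᵢ - 1) ≤ N`. Chains of three lines (`ProjFamily.exists_chain_of_cubic`) feed
`exists_pos_smul_mem_closure_lineClasses_of_chain`.
[cite: TianZong2014, Thm. 1.7, Prop. 7.1 and proof of Thm. 6.1] -/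
theorem exists_pos_smul_mem_closure_lineClasses_of_cubic {N : ℕ} (hN : 4 ≤ N) {X : SchemeOver k}
    (F : Fin 1 → MvPolynomial (Fin (N + 1)) k) (i : X ⟶ projectiveSpace N k)
    [IsClosedImmersion i.left] (hF : ∀ a, (F a).IsHomogeneous 3)
    (hrange : Set.range i.left.base =
      ProjectiveSpectrum.zeroLocus (homogeneousSubmodule (Fin (N + 1)) k) (Set.range F))
    (x : ChowGroup X.left 1) :
    ∃ e : ℕ, 0 < e ∧ (e : ℤ) • x ∈ AddSubgroup.closure (lineClasses N i) :=
  exists_pos_smul_mem_closure_lineClasses_of_chain (by omega) F (fun _ => 3) i hF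
    (fun _ => three_pos) hrange
    (fun L _ _ _ p q hp0 hq0 hp hq => exists_chain_of_cubic hN (fun a => (hF a).map _) p q hp0 hq0 hp hq)
    x

/-- Quotient form: `CH₁(X)/⟨lines⟩` is torsion for every cubic hypersurface `X ⊆ ℙᴺ`, `N ≥ 4`
(in particular for cubic threefolds). [cite: TianZong2014, Thm. 1.7, Prop. 7.1] -/
theorem isTorsion_chowGroupOne_quot_lineClasses_of_cubic {N : ℕ} (hN : 4 ≤ N) {X : SchemeOver k}
    (F : Fin 1 → MvPolynomial (Fin (N + 1)) k) (i : X ⟶ projectiveSpace N k)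
    [IsClosedImmersion i.left] (hF : ∀ a, (F a).IsHomogeneous 3)
    (hrange : Set.range i.left.base =
      ProjectiveSpectrum.zeroLocus (homogeneousSubmodule (Fin (N + 1)) k) (Set.range F)) :
    AddMonoid.IsTorsion (ChowGroup X.left 1 ⧸ AddSubgroup.closure (lineClasses N i)) :=
  isTorsion_chowGroupOne_quot_lineClasses_of_chain (by omega) F (fun _ => 3) i hF
    (fun _ => three_pos) hrange
    (fun L _ _ _ p q hp0 hq0 hp hq => exists_chain_of_cubic hN (fun a => (hF a).map _) p q hp0 hq0 hp hq)

/-- **`CH₁ ⊗ ℚ` of an intersection of two quadrics of dimension `≥ 3` is generated by its lines**: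
for `X ⊆ ℙᴺ_k` (`N ≥ 5`) a closed subscheme with underlying set `V₊(F₁, F₂)`, `F_a` quadratic
forms, every `x ∈ CH₁(X)` has a positive multiple in the subgroup generated by the line classes
(chains of three lines, `ProjFamily.exists_chain_of_two_quadrics`; the case `(2, 2) ⊆ ℙ⁵` is not
covered by `Σ (2 dᵢ - 1) ≤ N`). [cite: TianZong2014, Thm. 1.7, Prop. 7.1 and proof of Thm. 6.1] -/
theorem exists_pos_smul_mem_closure_lineClasses_of_two_quadrics {N : ℕ} (hN : 5 ≤ N)
    {X : SchemeOver k} (F : Fin 2 → MvPolynomial (Fin (N + 1)) k) (i : X ⟶ projectiveSpace N k)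
    [IsClosedImmersion i.left] (hF : ∀ a, (F a).IsHomogeneous 2)
    (hrange : Set.range i.left.base =
      ProjectiveSpectrum.zeroLocus (homogeneousSubmodule (Fin (N + 1)) k) (Set.range F))
    (x : ChowGroup X.left 1) :
    ∃ e : ℕ, 0 < e ∧ (e : ℤ) • x ∈ AddSubgroup.closure (lineClasses N i) :=
  exists_pos_smul_mem_closure_lineClasses_of_chain (by omega) F (fun _ => 2) i hF
    (fun _ => two_pos) hrange
    (fun L _ _ _ p q hp0 hq0 hp hq =>
      exists_chain_of_two_quadrics hN (fun a => (hF a).map _) p q hp0 hq0 hp hq)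
    x

/-- Quotient form: `CH₁(X)/⟨lines⟩` is torsion for every intersection of two quadrics
`X ⊆ ℙᴺ`, `N ≥ 5`. [cite: TianZong2014, Thm. 1.7, Prop. 7.1] -/
theorem isTorsion_chowGroupOne_quot_lineClasses_of_two_quadrics {N : ℕ} (hN : 5 ≤ N)
    {X : SchemeOver k} (F : Fin 2 → MvPolynomial (Fin (N + 1)) k) (i : X ⟶ projectiveSpace N k)
    [IsClosedImmersion i.left] (hF : ∀ a, (F a).IsHomogeneous 2)
    (hrange : Set.range i.left.base =
      ProjectiveSpectrum.zeroLocus (homogeneousSubmodule (Fin (N + 1)) k) (Set.range F)) :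
    AddMonoid.IsTorsion (ChowGroup X.left 1 ⧸ AddSubgroup.closure (lineClasses N i)) :=
  isTorsion_chowGroupOne_quot_lineClasses_of_chain (by omega) F (fun _ => 2) i hF
    (fun _ => two_pos) hrange
    (fun L _ _ _ p q hp0 hq0 hp hq =>
      exists_chain_of_two_quadrics hN (fun a => (hF a).map _) p q hp0 hq0 hp hq)

end TorsionChain

end Literature.AlgebraicGeometry.Motives

end
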